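import Summits.QuantumFields.BalabanUV.Beta.MultiscaleParametrixCubesWRS
import Summits.QuantumFields.BalabanUV.Beta.MultiscaleParametrixCubesMargin

/-!
# Beta / MultiscaleParametrixCubesWRSMargin — THE (w4-d)-FLAT PROGRAMME CLOSED AT MODEL LEVEL FOR THE CUBE FAMILY WITH THE HULLS WITH MARGIN
# `cubeHullR`: `MultiscaleParametrixCubesWRS.parametrix_cubes_wrs` with its six hull clauses DISCHARGED by `MultiscaleParametrixCubesMargin`
# (`cubeHullR_clauses`, `cubeHullR_eq_one_of_dist_le`) from (G2) at the enlarged radius and ONE margin inequality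
# `mg ≥ (2d + (8d+3)·L^A·e^{(log L∕R)(8d+3)})·L` — so the WRS-currency parametrix of the multi-region MODEL operator holds for print's own
# cube-indexed partition of unity with hulls `Ω₀(□)` = cells meeting the `(((d+2)M + mg)S_j + 1)`-ball, its remaining inputs being the layer
# predicate's (C0)(C1)(C2)(G1), (G2) and the hull count (G3) — exactly the DATA of gen 10's ℓ² END `parametrix_cubes` plus the margin
# (MODEL; flat transport, constant bond weight; claim «WRS-PARAMETRIX-FLAT» journal l.25540; unit `b2b-balaban-beta-d4-p2`, GEN 12, MODEL crew)

RESULT **`parametrix_cubesR_wrs`**: `1 − R′` a unit, `(levelOp)⁻¹ = G′₀(1 − R′)⁻¹`, `WRS_{κ′,d_n}(cmat R′) ≤ νC_K`, `WRS_{κ′,d_n}(cmat (1 − R′)⁻¹) ≤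
(1 − νC_K)⁻¹`, **`wrs_{κ′,d_n}(cmat (levelOp)⁻¹)(p) ≤ ν·𝔅_W·n(p₁)²∕(1 − νC_K)`**, `C_K = C_K⁰∕M` LEVEL-FREE, for `R′`, `G′₀` built on
`cubeFam`∕`cubeHullR mg`.  (FG) is a HYPOTHESIS for general `d` (d = 4: `FlatGradientBinderD4.flatGradient_binder_d4 hcc hc₀`).

HONEST FRAMING: discharging `BetaPertH` makes Bałaban's UV stability UNCONDITIONAL — NOT the continuum limit, NOT the
Clay problem.  HONEST DEPENDENCY (verbatim): «continuum YM on T⁴ ⇐ BetaPertH ∧ nine spine estimates (0/9 proved);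
BetaPertH ⇐ (D1) ∧ (D4) ∧ CAP+tail; G-an2-4 gates asym, D1 and NE2/3/4.»  THIS MODULE DISCHARGES NOTHING of `BetaPertH`,
asserts NOTHING printed and cites nothing as a fact (ABSOLUTE RULE): [folklore] assembly BY NAME about pv21's component MODEL; the layer
predicate, (C0)–(C2), (G1), (G2), (G3) are DATA.  Nothing of Bałaban's G′(U)∕random-walk expansion is asserted ((3.87)–(3.91) + Thm 3.7 of
[Balaban1985BackgroundPropagators], (2.36)–(2.40) of [Balaban1984PropagatorsII], (2.16) of [Balaban1988RG2Cluster] are LOCI).  No class change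
on row D4 (critical-path width 0; D4 DISCHARGE NO DATE); NOT BetaPertH, NOT continuum, NOT Clay, NOT summit progress.
-/

open scoped BigOperators
open Finset

namespace Summit.QuantumFields.BalabanUV.Beta.MultiscaleParametrixCubesWRSMargin

open Summit.QuantumFields.BalabanUV.Beta.BoxPoincare (Box)
open Summit.QuantumFields.BalabanUV.Beta.MultiscaleCoerciveTorus
open Summit.QuantumFields.BalabanUV.Beta.MultiscaleDistance
open Summit.QuantumFields.BalabanUV.Beta.MultiscaleDecayBudget
open Summit.QuantumFields.BalabanUV.Beta.SubsolutionMeanValueBox (Cmv)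
open Summit.QuantumFields.BalabanUV.Beta.MultiscaleParametrixCubesWRS (parametrix_cubes_wrs)
open Summit.QuantumFields.BalabanUV.Beta.MultiscaleParametrixCubesMargin
open Summit.QuantumFields.BalabanUV.Beta.MultiscaleParametrixHull (CellMeets)
open Summit.QuantumFields.BalabanUV.Beta.MultiscaleCubesFamily
open Summit.QuantumFields.BalabanUV.Beta.MultiscaleParametrixCubes
open Summit.QuantumFields.BalabanUV.Beta.MultiscaleParametrixBoxes (one_le_MS)
open Summit.QuantumFields.BalabanUV.Beta.CovariantTowerMatrix (cmat)
open Literature.MathematicalPhysics.QuantumFieldTheory.Balaban1983to89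
open Literature.MathematicalPhysics.QuantumFieldTheory.Balaban1983to89.B9Thm37GluePU (bsrc btgt)
open Literature.MathematicalPhysics.QuantumFieldTheory.Balaban1983to89.B9Thm37GlueTorusCov (tblk)
open Literature.MathematicalPhysics.QuantumFieldTheory.Balaban1983to89.B9Thm37GlueTorusCovLevels (levelOp levelSum)
open Literature.MathematicalPhysics.QuantumFieldTheory.Balaban1983to89.B13PerturbativeStep (WRS wrs)
open Summit.QuantumFields.BalabanUV.Beta.MultiscaleParametrix (G0sum Rsum)
open B5TorusCover (UT Ctr ctrU)
open B5Leibniz121 (up)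

noncomputable section

/-- The margin arithmetic: `r₀ + (8d+3)ΓLS ≤ ((d+2)M + mg)S + 1` from `(2d + (8d+3)Γ)L ≤ mg` and `S ≥ 1`. [folklore] -/
theorem margin_arith (D M' S' L' Γ' mg' δ' : ℝ) (hS' : 1 ≤ S') (hmg' : (2 * D + (8 * D + 3) * Γ') * L' ≤ mg')
    (hy : δ' ≤ (D + 2) * (M' * S') + 2 * D * (L' * S') + 1 + (8 * D + 3) * Γ' * (L' * S')) :
    δ' ≤ ((D + 2) * M' + mg') * S' + 1 := by
  have hm : (2 * D + (8 * D + 3) * Γ') * L' * S' ≤ mg' * S' := mul_le_mul_of_nonneg_right hmg' (by linarith)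
  nlinarith

variable {d : ℕ} {N : Fin d → ℕ} [∀ i, NeZero (N i)] [NeZero d] {Cp J K : Type} [Fintype Cp] [DecidableEq Cp] [Nonempty Cp]
  [Fintype J] [DecidableEq J] [Fintype K] [DecidableEq K] (S : J → ℕ) (hS : ∀ l, 1 ≤ S l) (hdivS : ∀ l i, S l ∣ N i) (lvl : K → J)
  (zc : (k : K) → Ctr N (S (lvl k)))
  (hdisj : ∀ k k' v v', cellPt S hS hdivS lvl zc k v = cellPt S hS hdivS lvl zc k' v' → k = k')
  (hcover : ∀ x : UT N, ∃ k, ∃ v : Box d (S (lvl k)), cellPt S hS hdivS lvl zc k v = x)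
  (Rm : UT N × Fin d → Cp → Cp → ℝ) (hRm : ∀ b i j, ∑ k, Rm b k i * Rm b k j = if i = j then (1 : ℝ) else 0)
  (hflat : ∀ b k i, Rm b k i = if k = i then 1 else 0)
  (T : J → UT N → Cp → Cp → ℝ) (hT : ∀ l x i i', ∑ k, T l x k i * T l x k i' = if i = i' then (1 : ℝ) else 0)
  (a : J → ℝ) (ha : ∀ j, 0 ≤ a j) (ω : J → UT N → ℝ)
  (hsupp : ∀ l x, ω l (ctrU N (S l) (tblk (hS l) (hdivS l) x)) ≠ 0 → ∃ k v, lvl k = l ∧ cellPt S hS hdivS lvl zc k v = x)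
  {amax : ℝ} (hamax : 0 ≤ amax)
  (hscale : ∀ k, a (lvl k) * ω (lvl k) (ctrU N (S (lvl k)) (zc k)) ^ 2 * (S (lvl k) : ℝ) ^ d ≤ amax / (S (lvl k) : ℝ) ^ 2)
  (c : UT N × Fin d → ℝ) {c₀ : ℝ} (hcc : ∀ b, c b = c₀) (hc₀ : c₀ ≠ 0)
  {L : ℕ} (hL : 1 ≤ L) (e : J → ℕ) (hSe : ∀ l, S l = L ^ e l) {R : ℝ} (hR : 0 < R) {A : ℕ}
  (hadd : ∀ x y : UT N, |(e (lvl (cellOf S hS hdivS lvl zc hcover x)) : ℝ) - e (lvl (cellOf S hS hdivS lvl zc hcover y))| ≤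
    A + sdist bsrc btgt (siteScale S hS hdivS lvl zc hcover) x y / R)
  {cmax : ℝ} (hc : ∀ b, |c b| ≤ cmax) {C : ℝ} (hC : 0 < C)
  (hcoer : ∀ f : UT N × Cp → ℝ,
    C * ∑ k, ((S (lvl k) : ℝ) ^ 2)⁻¹ * ∑ v : Box d (S (lvl k)), ∑ i, f (cellPt S hS hdivS lvl zc k v, i) ^ 2 ≤
      ∑ p, f p * levelOp bsrc btgt c Rm (fun l x => ctrU N (S l) (tblk (hS l) (hdivS l) x))
        (fun l x => ω l (ctrU N (S l) (tblk (hS l) (hdivS l) x))) T a f p)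
  {κ : ℝ} (hκ0 : 0 ≤ κ) (hκ1 : κ ≤ 1) (hμ : 0 < C - 2 * d * cmax ^ 2 * κ ^ 2 - amax * (Real.exp (2 * d * κ) - 1))
  (hrate : (1 + d / 2) * (Real.log L / R) ≤ κ)
  {Γ θ δ 𝔅 𝔅g K₁ K₂ : ℝ} (hΓ : Γ = (L : ℝ) ^ A * Real.exp (Real.log L / R * (4 * d + 1))) (hθ : θ = 1 / (4 * d * Γ))
  (hδ : δ = κ - (1 + d / 2) * (Real.log L / R))
  (h𝔅 : 𝔅 = (max (Real.sqrt (11 ^ d)) (Cmv d * Real.sqrt (21 ^ d)) / Real.sqrt (θ ^ d) +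
          Real.sqrt (Fintype.card Cp) * (θ + 1) ^ 2 * (amax * Γ ^ 2 * Real.sqrt (Γ ^ d)) / (2 * c₀ ^ 2)) *
        (Real.sqrt (Fintype.card Cp) * Real.exp (κ * ((4 * d + 1) + 2 * d)) *
          ((L : ℝ) ^ A * Real.exp (Real.log L / R * (4 * d + 1))) * (L : ℝ) ^ A * Real.sqrt (((L : ℝ) ^ A) ^ d) /
          min (C - 2 * d * cmax ^ 2 * κ ^ 2 - amax * (Real.exp (2 * d * κ) - 1)) 1) +
        Real.sqrt (Fintype.card Cp) * (θ + 1) ^ 2 / (2 * c₀ ^ 2) *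
          Real.exp ((κ - (1 + d / 2) * (Real.log L / R)) * ((4 * d + 1) + 2 * d)))
  (hK₁ : 0 ≤ K₁) (hK₂ : 0 ≤ K₂)
  (h𝔅g : 𝔅g = |c₀| * (𝔅 * (Γ ^ 2 * Real.exp δ + 1) * (16 * d * Γ) + K₁ * 𝔅 * Γ ^ 2 * Real.exp δ * (16 * d * Γ) +
      K₂ * (θ / 4 + 1) * (Real.exp (δ * (2 * d + 1)) + amax * Real.sqrt (Fintype.card Cp) * 𝔅 * Real.exp (δ * (4 * d + 1))) / c₀ ^ 2))
  -- the cube family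
  (M : ℕ) (hM : 1 ≤ M) (hMdiv : ∀ j i, M * S j ∣ N i) (inLayer : (j : J) → Ctr N (M * S j) → Prop)
  (h2N : ∀ j i, 2 * (M * S j) ≤ N i) (hcov : ∀ x, ∃ j, inLayer j (tblk (one_le_MS S hS hM j) (hMdiv j) x))
  (hcmp : ∀ (p q : Σ j : J, Ctr N (M * S j)) (x y : UT N), dist x y ≤ 2 →
    rawFam S hS M hM hMdiv inLayer p x ≠ 0 → rawFam S hS M hM hMdiv inLayer q y ≠ 0 → S p.1 ≤ L * S q.1) {nadj : ℕ}
  (hlay : ∀ x, (univ.filter fun j : J => ∃ z : Ctr N (M * S j), rawFam S hS M hM hMdiv inLayer ⟨j, z⟩ x ≠ 0).card ≤ nadj)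
  (hfar : ∀ (p : Σ j : J, Ctr N (M * S j)) k, ¬ (S p.1 ≤ L * S (lvl k) ∧ S (lvl k) ≤ L * S p.1) →
    ∀ v, cubeFam S hS M hM hMdiv inLayer p (cellPt S hS hdivS lvl zc k v) = 0)
  -- the margin and (G2) at the enlarged radius, the hull count (G3)
  (mg : ℕ) (hmg : (2 * d + (8 * d + 3) * ((L : ℝ) ^ A * Real.exp (Real.log L / R * (8 * d + 3)))) * L ≤ mg)
  (hballs : ∀ (j : J) (z : Ctr N (M * S j)), (∃ y, cubeFam S hS M hM hMdiv inLayer ⟨j, z⟩ y ≠ 0) →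
    ∀ k, CellMeets S hS hdivS lvl zc k (ctrU N (M * S j) z) (((((d + 2) * M + mg) * S j : ℕ) : ℝ) + 1) → S (lvl k) ≤ L * S j)
  {ν : ℝ} (hν : ∀ x, ∑ z, cubeHullR S hS hdivS lvl zc M hM hMdiv inLayer hcover mg z x ≤ ν)

include hdisj hT ha hsupp hamax hscale hL e hSe hR hadd hRm hflat hcc hc₀ hc hC hcoer hκ0 hκ1 hμ hrate hΓ hθ hδ h𝔅 hK₁ hK₂ h𝔅g h2N hcov
  hcmp hlay hfar hmg hballs hν

/-- **THE WRS-CURRENCY PARAMETRIX FOR THE CUBE FAMILY WITH THE HULLS WITH MARGIN (MODEL; flat transport; (FG) a hypothesis — d = 4: pass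
`FlatGradientBinderD4.flatGradient_binder_d4 hcc hc₀`).**  `MultiscaleParametrixCubesWRS.parametrix_cubes_wrs` for `χ = cubeHullR mg` with the
hull clauses discharged: `hχ`, `hχcell`, `hsite`, `hbond`, `hH` by `cubeHullR_clauses` ((G2) `hballs` at radius `((d+2)M + mg)S_j + 1`), the
hull-margin clause by `cubeHullR_eq_one_of_dist_le` and `mg ≥ (2d + (8d+3)·L^A·e^{(log L∕R)(8d+3)})·L`.  Conclusions as there:
**`wrs_{κ′,d_n}(cmat (levelOp)⁻¹)(p) ≤ ν·𝔅_W·n(p₁)²∕(1 − νC_K)`** with `C_K = C_K⁰∕M`, every constant seeing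
`d, L, A, R, n_adj, c₀, c_max, a_max, C, κ, κ′, ε, |Cp|, K₁, K₂` ONLY — «M sufficiently large» LEVEL-FREE.
[cite: Balaban1985BackgroundPropagators, (3.87)–(3.91) pp.408–409 + Thm 3.7; Balaban1984PropagatorsII, (2.36)–(2.40) pp.229–230; Balaban1988RG2Cluster, (2.16) p.15] [folklore] -/
theorem parametrix_cubesR_wrs
    (hFG : ∀ (x₀ : UT N) (R : ℕ), 1 ≤ R → (∀ i, 10 * R + 4 ≤ N i) → ∀ (w : UT N → ℝ) (M G : ℝ),
      (∀ x ∈ univ.filter (fun x : UT N => dist x x₀ ≤ 2 * R + 2), |w x| ≤ M) →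
      (∀ x ∈ univ.filter (fun x : UT N => dist x x₀ ≤ 2 * R + 2),
        |((∑ b ∈ univ.filter (fun b : UT N × Fin d => btgt b = x), c b ^ 2) +
              ∑ b ∈ univ.filter (fun b : UT N × Fin d => bsrc b = x), c b ^ 2) * w x -
            ((∑ b ∈ univ.filter (fun b : UT N × Fin d => btgt b = x), c b ^ 2 * w (bsrc b)) +
              ∑ b ∈ univ.filter (fun b : UT N × Fin d => bsrc b = x), c b ^ 2 * w (btgt b))| ≤ G) →
      ∀ μ, |w (up x₀ μ) - w x₀| ≤ K₁ * M / ((R : ℝ) + 1) + K₂ * ((R : ℝ) + 1) * G / c₀ ^ 2)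
    {ε : ℝ} (hε : 0 < ε) {κ' : ℝ} (hκ'0 : 0 ≤ κ') (hκ'δ : κ' ≤ δ)
    (hq : Real.exp (ε + 2 * (Real.log L / R) * d) * Real.exp (-(δ - κ')) < 1)
    {Ngr 𝔅W 𝔅D CK : ℝ}
    (hNgr : Ngr = (3 * ((L : ℝ) ^ A) ^ 2) ^ d * ((d.factorial : ℝ) / ε ^ d) * Real.exp (2 * d * (ε + Real.log L / R * d)) *
        Real.exp (ε + 2 * (Real.log L / R) * d) / (1 - Real.exp (ε + 2 * (Real.log L / R) * d) * Real.exp (-(δ - κ'))))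
    (h𝔅W : 𝔅W = 𝔅 * Real.exp (2 * d * δ) * Ngr) (h𝔅D : 𝔅D = 𝔅g * Real.exp (2 * d * δ) * Ngr)
    (hCK : CK = (d * |c₀| * K1 d L nadj * L * (1 + Real.exp κ') * 𝔅D + |c₀| ^ 2 * (d * K2 d L nadj) * L ^ 2 * 𝔅W / M +
        2 * (d * L * K1 d L nadj) * Real.exp (4 * d * κ') * Fintype.card Cp * amax * 𝔅W) / M)
    (hsmall : ν * CK < 1) :
    IsUnit (1 - Rsum bsrc btgt c Rm
        (levelSum (fun l x => ctrU N (S l) (tblk (hS l) (hdivS l) x)) (fun l x => ω l (ctrU N (S l) (tblk (hS l) (hdivS l) x))) T a)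
        (levelOp bsrc btgt c Rm (fun l x => ctrU N (S l) (tblk (hS l) (hdivS l) x))
          (fun l x => ω l (ctrU N (S l) (tblk (hS l) (hdivS l) x))) T a)
        (cubeFam S hS M hM hMdiv inLayer)
          (cubeHullR S hS hdivS lvl zc M hM hMdiv inLayer hcover mg)) ∧
      Ring.inverse (levelOp bsrc btgt c Rm (fun l x => ctrU N (S l) (tblk (hS l) (hdivS l) x))
          (fun l x => ω l (ctrU N (S l) (tblk (hS l) (hdivS l) x))) T a) =
        G0sum (levelOp bsrc btgt c Rm (fun l x => ctrU N (S l) (tblk (hS l) (hdivS l) x))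
          (fun l x => ω l (ctrU N (S l) (tblk (hS l) (hdivS l) x))) T a) (cubeFam S hS M hM hMdiv inLayer)
          (cubeHullR S hS hdivS lvl zc M hM hMdiv inLayer hcover mg) *
        Ring.inverse (1 - Rsum bsrc btgt c Rm
          (levelSum (fun l x => ctrU N (S l) (tblk (hS l) (hdivS l) x)) (fun l x => ω l (ctrU N (S l) (tblk (hS l) (hdivS l) x))) T a)
          (levelOp bsrc btgt c Rm (fun l x => ctrU N (S l) (tblk (hS l) (hdivS l) x))
            (fun l x => ω l (ctrU N (S l) (tblk (hS l) (hdivS l) x))) T a)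
          (cubeFam S hS M hM hMdiv inLayer)
          (cubeHullR S hS hdivS lvl zc M hM hMdiv inLayer hcover mg)) ∧
      WRS κ' (fun p q : UT N × Cp => sdist bsrc btgt (siteScale S hS hdivS lvl zc hcover) p.1 q.1)
        (cmat (Ring.inverse (1 - Rsum bsrc btgt c Rm
          (levelSum (fun l x => ctrU N (S l) (tblk (hS l) (hdivS l) x)) (fun l x => ω l (ctrU N (S l) (tblk (hS l) (hdivS l) x))) T a)
          (levelOp bsrc btgt c Rm (fun l x => ctrU N (S l) (tblk (hS l) (hdivS l) x))
            (fun l x => ω l (ctrU N (S l) (tblk (hS l) (hdivS l) x))) T a)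
          (cubeFam S hS M hM hMdiv inLayer)
          (cubeHullR S hS hdivS lvl zc M hM hMdiv inLayer hcover mg)))) (1 - ν * CK)⁻¹ ∧
      WRS κ' (fun p q : UT N × Cp => sdist bsrc btgt (siteScale S hS hdivS lvl zc hcover) p.1 q.1)
        (cmat (Rsum bsrc btgt c Rm
          (levelSum (fun l x => ctrU N (S l) (tblk (hS l) (hdivS l) x)) (fun l x => ω l (ctrU N (S l) (tblk (hS l) (hdivS l) x))) T a)
          (levelOp bsrc btgt c Rm (fun l x => ctrU N (S l) (tblk (hS l) (hdivS l) x))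
            (fun l x => ω l (ctrU N (S l) (tblk (hS l) (hdivS l) x))) T a)
          (cubeFam S hS M hM hMdiv inLayer)
          (cubeHullR S hS hdivS lvl zc M hM hMdiv inLayer hcover mg))) (ν * CK) ∧
      ∀ p : UT N × Cp, wrs κ' (fun p q : UT N × Cp => sdist bsrc btgt (siteScale S hS hdivS lvl zc hcover) p.1 q.1)
        (cmat (Ring.inverse (levelOp bsrc btgt c Rm (fun l x => ctrU N (S l) (tblk (hS l) (hdivS l) x))
          (fun l x => ω l (ctrU N (S l) (tblk (hS l) (hdivS l) x))) T a))) p ≤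
        ν * (𝔅W * (siteScale S hS hdivS lvl zc hcover p.1 : ℝ) ^ 2) / (1 - ν * CK) := by
  obtain ⟨hχ, hχcell, hsite, hbond, hH⟩ := cubeHullR_clauses S hS hdivS lvl zc M hM hMdiv inLayer hcover hdisj mg hballs
  -- the hull-margin clause
  have hχball : ∀ z : Σ j : J, Ctr N (M * S j), (∃ y, cubeFam S hS M hM hMdiv inLayer z y ≠ 0) → ∀ y : UT N,
      dist y (ctrU N (M * S z.1) z.2) ≤ ((((d + 2) * (M * S z.1) : ℕ) : ℝ) + 2 * d * (L * S z.1) + 1) +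
        (8 * d + 3) * ((L : ℝ) ^ A * Real.exp (Real.log L / R * (8 * d + 3))) * (L * S z.1) →
      cubeHullR S hS hdivS lvl zc M hM hMdiv inLayer hcover mg z y = 1 := by
    intro z hact y hy
    refine cubeHullR_eq_one_of_dist_le S hS hdivS lvl zc M hM hMdiv inLayer hcover mg z hact ?_
    have hSj : (1 : ℝ) ≤ S z.1 := by exact_mod_cast hS z.1
    push_cast at hy ⊢
    exact margin_arith _ _ _ _ _ _ _ hSj hmg hy
  exact parametrix_cubes_wrs S hS hdivS lvl zc hdisj hcover Rm hRm hflat T hT a ha ω hsupp hamax hscale c hcc hc₀ hL e hSe hR hadd hc hC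
    hcoer hκ0 hκ1 hμ hrate hΓ hθ hδ h𝔅 hK₁ hK₂ h𝔅g M hM hMdiv inLayer h2N hcov hcmp hlay hfar
    (cubeHullR S hS hdivS lvl zc M hM hMdiv inLayer hcover mg) hχ hχcell hsite hbond hH hχball hν hFG hε hκ'0 hκ'δ hq hNgr h𝔅W h𝔅D
    hCK hsmall

end

end Summit.QuantumFields.BalabanUV.Beta.MultiscaleParametrixCubesWRSMargin

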